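import Literature.NumberTheory.LFunctions.MoebiusAutomaticCarry
import HarnessLib

/-!
# The carry property on hyperbolic boxes: Müllner 2017, Lemma 5.2 (Mauduit–Rivat 2015, "cut" lemma), proved

Everything in this file is PROVED. It derives from the carry property (Def. 4.1,
`HasCarryProperty`, `MoebiusAutomaticCarry.lean`) the form in which it enters the type-II
estimate of the Mauduit–Rivat method (C. Müllner, *Automatic sequences fulfill the Sarnak
conjecture*, Duke Math. J. 166 (2017), Lemma 5.2, quoted from Mauduit–Rivat, J. Eur. Math. Soc.
17 (2015) with "the proof stays unchanged"):

> Let `f` satisfy Def. 4.1 with `η > 0`. For `(μ, ν, ρ)` with `2ρ < ν`, the set `E` of pairs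
> `(m, n) ∈ [k^{μ-1}, k^μ) × [k^{ν-1}, k^ν)` for which some `ℓ < k^{μ+ρ}` has
> `f(mn+ℓ)^H f(mn) ≠ f_{μ+2ρ}(mn+ℓ)^H f_{μ+2ρ}(mn)` satisfies `#E ≪ (log k) k^{μ+ν−ηρ}`.

Here (group-valued `f`, the tree's prefix-cancelling quotient `f(x) f(y)⁻¹`, cf. the module
docstring of `MoebiusAutomaticCarry.lean`) with the explicit constant `3 k C` in place of
`≪ log k`: `#E ≤ 3 k C · k^{μ+ν−ηρ}` (`card_carryExceptionsBox_le`). Proof: with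
`α = μ + ρ`, `λ = ν − ρ` (`ρ < λ ⟺ 2ρ < ν`), `mn = ℓ' k^α + n₁` (`ℓ' = ⌊mn/k^α⌋ < k^λ`,
`n₁ = mn mod k^α`) and `n₂ = ℓ`, a pair in `E` has `ℓ'` among the carry violations of scale
`(λ, α, ρ)` (`carryExceptionsBox_subset`), of which there are `≤ C k^{λ−ηρ}`; and for fixed `m`
and `ℓ'` at most `k^{μ+ρ}/m + 2 ≤ k^{ρ+1} + 2` values of `n` have `⌊mn/k^{μ+ρ}⌋ = ℓ'`
(`card_filter_mul_div_eq_le`).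

## References
* C. Müllner, Duke Math. J. 166 (2017) = arXiv:1602.03042, Lemma 5.2 (p. 27). [Mullner2017]
* C. Mauduit, J. Rivat, J. Eur. Math. Soc. 17 (2015) 2595–2642 (the original lemma; cited
  through Müllner 2017).
-/

noncomputable section

open Finset

namespace Literature.NumberTheory.LFunctions

section CarryBox

variable {G : Type*} [Group G]

/-- The exceptional set of Lemma 5.2: pairs `(m, n)` in the box
`[k^{μ-1}, k^μ) × [k^{ν-1}, k^ν)` for which some `ℓ < k^{μ+ρ}` violates
`f(mn+ℓ) f(mn)⁻¹ = f_{μ+2ρ}(mn+ℓ) f_{μ+2ρ}(mn)⁻¹` (`f_P(x) = f(x mod k^P)`).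
[cite: Mullner2017, Lemma 5.2] -/
def carryExceptionsBox (k : ℕ) (f : ℕ → G) (μ ν ρ : ℕ) : Finset (ℕ × ℕ) := by
  classical
  exact (Ico (k ^ (μ - 1)) (k ^ μ) ×ˢ Ico (k ^ (ν - 1)) (k ^ ν)).filter fun p =>
    ∃ ℓ < k ^ (μ + ρ), f (p.1 * p.2 + ℓ) * (f (p.1 * p.2))⁻¹ ≠
      f ((p.1 * p.2 + ℓ) % k ^ (μ + 2 * ρ)) * (f ((p.1 * p.2) % k ^ (μ + 2 * ρ)))⁻¹

/-- Membership in `carryExceptionsBox`. [folklore] -/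
theorem mem_carryExceptionsBox {k : ℕ} {f : ℕ → G} {μ ν ρ : ℕ} {p : ℕ × ℕ} :
    p ∈ carryExceptionsBox k f μ ν ρ ↔
      (k ^ (μ - 1) ≤ p.1 ∧ p.1 < k ^ μ) ∧ (k ^ (ν - 1) ≤ p.2 ∧ p.2 < k ^ ν) ∧
      ∃ ℓ < k ^ (μ + ρ), f (p.1 * p.2 + ℓ) * (f (p.1 * p.2))⁻¹ ≠
        f ((p.1 * p.2 + ℓ) % k ^ (μ + 2 * ρ)) * (f ((p.1 * p.2) % k ^ (μ + 2 * ρ)))⁻¹ := by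
  classical
  simp [carryExceptionsBox, and_assoc]

/-- **The exceptions project into the carry violations** of scale `(λ, α, ρ) = (ν−ρ, μ+ρ, ρ)`:
`(m,n) ∈ E ⇒ ⌊mn/k^{μ+ρ}⌋ ∈ carryViolations(ν−ρ, μ+ρ, ρ)` (take `n₁ = mn mod k^{μ+ρ}`,
`n₂ = ℓ`). [cite: Mullner2017, Lemma 5.2 (proof)] -/
theorem carryExceptionsBox_subset {k : ℕ} (hk : 2 ≤ k) (f : ℕ → G) (μ ν ρ : ℕ) {p : ℕ × ℕ}
    (hp : p ∈ carryExceptionsBox k f μ ν ρ) :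
    p.1 * p.2 / k ^ (μ + ρ) ∈ carryViolations k f (ν - ρ) (μ + ρ) ρ := by
  have hk0 : 0 < k := by omega
  rw [mem_carryExceptionsBox] at hp
  obtain ⟨⟨-, hm⟩, ⟨-, hn⟩, ℓ, hℓ, hne⟩ := hp
  set K := k ^ (μ + ρ) with hK
  have hKpos : 0 < K := pow_pos hk0 _
  rw [mem_carryViolations]
  refine ⟨?_, p.1 * p.2 % K, Nat.mod_lt _ hKpos, ℓ, hℓ, ?_⟩
  · -- `mn < k^{μ+ν} = k^{μ+ρ} k^{ν-ρ}` (if `ρ ≤ ν`; otherwise `k^{ν-ρ} = 1` still bounds nothing: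
    -- but then `mn / K < 1 ≤ k^0`, fine)
    rw [Nat.div_lt_iff_lt_mul hKpos, hK, ← pow_add]
    calc p.1 * p.2 < k ^ μ * k ^ ν := Nat.mul_lt_mul_of_lt_of_le hm hn.le (pow_pos hk0 _)
      _ = k ^ (μ + ν) := (pow_add k μ ν).symm
      _ ≤ k ^ (ν - ρ + (μ + ρ)) := Nat.pow_le_pow_right hk0 (by omega)
  · have hmn : p.1 * p.2 / K * K + p.1 * p.2 % K = p.1 * p.2 := Nat.div_add_mod' _ _
    rw [show μ + ρ + ρ = μ + 2 * ρ by ring, hmn]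
    exact hne

/-- **Counting one hyperbola strip**: for `m ≥ 1`, `K ≥ 1`, at most `K/m + 2` integers `n`
in any finite set have `⌊mn/K⌋ = ℓ'` (they lie in an interval of length `≤ K/m + 1`). [folklore] -/
theorem card_filter_mul_div_eq_le {m K : ℕ} (hm : 0 < m) (hK : 0 < K) (s : Finset ℕ) (ℓ' : ℕ) :
    (s.filter fun n => m * n / K = ℓ').card ≤ K / m + 2 := by
  calc (s.filter fun n => m * n / K = ℓ').card
      ≤ (Ico (ℓ' * K / m) ((ℓ' * K + K) / m + 1)).card := by
        refine card_le_card fun n hn => ?_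
        rw [mem_filter] at hn
        obtain ⟨-, h⟩ := hn
        have h1 : ℓ' * K ≤ m * n := by rw [← h]; exact Nat.div_mul_le_self _ _
        have h2 : m * n < ℓ' * K + K := by rw [← h]; exact Nat.lt_div_mul_add hK
        rw [mem_Ico]
        constructor
        · calc ℓ' * K / m ≤ m * n / m := Nat.div_le_div_right h1
            _ = n := Nat.mul_div_cancel_left n hm
        · have : n ≤ (ℓ' * K + K) / m := by
            calc n = m * n / m := (Nat.mul_div_cancel_left n hm).symm
              _ ≤ (ℓ' * K + K) / m := Nat.div_le_div_right h2.le
          omega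
    _ = (ℓ' * K + K) / m + 1 - ℓ' * K / m := Nat.card_Ico _ _
    _ ≤ K / m + 2 := by
        have hB : (ℓ' * K + K) / m ≤ ℓ' * K / m + K / m + 1 := by
          rw [Nat.add_div hm]
          split_ifs <;> omega
        generalize (ℓ' * K + K) / m = B at hB ⊢
        generalize ℓ' * K / m = A at hB ⊢
        generalize K / m = D at hB ⊢
        omega

/-- The exceptions of a fixed left factor `m` and a fixed quotient `ℓ'`. [folklore] -/
theorem card_filter_box_div_eq_le {k : ℕ} (hk : 2 ≤ k) (μ ν ρ ℓ' : ℕ) :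
    ((Ico (k ^ (μ - 1)) (k ^ μ) ×ˢ Ico (k ^ (ν - 1)) (k ^ ν)).filter
        fun p : ℕ × ℕ => p.1 * p.2 / k ^ (μ + ρ) = ℓ').card ≤ k ^ μ * (k ^ (ρ + 1) + 2) := by
  have hk0 : 0 < k := by omega
  have hKpos : 0 < k ^ (μ + ρ) := pow_pos hk0 _
  rw [card_filter, sum_product]
  calc ∑ m ∈ Ico (k ^ (μ - 1)) (k ^ μ), ∑ n ∈ Ico (k ^ (ν - 1)) (k ^ ν),
        (if m * n / k ^ (μ + ρ) = ℓ' then 1 else 0)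
      = ∑ m ∈ Ico (k ^ (μ - 1)) (k ^ μ),
          ((Ico (k ^ (ν - 1)) (k ^ ν)).filter fun n => m * n / k ^ (μ + ρ) = ℓ').card := by
        refine sum_congr rfl fun m _ => ?_
        rw [card_filter]
    _ ≤ ∑ _m ∈ Ico (k ^ (μ - 1)) (k ^ μ), (k ^ (ρ + 1) + 2) := by
        refine sum_le_sum fun m hm => ?_
        rw [mem_Ico] at hm
        have hm0 : 0 < m := lt_of_lt_of_le (pow_pos hk0 _) hm.1
        refine (card_filter_mul_div_eq_le hm0 hKpos _ ℓ').trans ?_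
        have : k ^ (μ + ρ) / m ≤ k ^ (ρ + 1) := by
          calc k ^ (μ + ρ) / m ≤ k ^ (μ + ρ) / k ^ (μ - 1) := Nat.div_le_div_left hm.1 (pow_pos hk0 _)
            _ = k ^ (μ + ρ - (μ - 1)) := Nat.pow_div (by omega) hk0
            _ ≤ k ^ (ρ + 1) := Nat.pow_le_pow_right hk0 (by omega)
        omega
    _ ≤ k ^ μ * (k ^ (ρ + 1) + 2) := by
        rw [sum_const, Nat.card_Ico, smul_eq_mul]
        exact Nat.mul_le_mul_right _ (Nat.sub_le _ _)

/-- **Müllner 2017, Lemma 5.2** (Mauduit–Rivat's cut lemma) with an explicit constant: if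
`f : ℕ → G` has the carry property `HasCarryProperty k η C` (`k ≥ 2`) then for `2ρ < ν` the
number of pairs `(m,n) ∈ [k^{μ-1}, k^μ) × [k^{ν-1}, k^ν)` for which some `ℓ < k^{μ+ρ}` violates
`f(mn+ℓ) f(mn)⁻¹ = f_{μ+2ρ}(mn+ℓ) f_{μ+2ρ}(mn)⁻¹` is at most `3 k C · k^{μ+ν−ηρ}`
(the paper: `≪ (log k) k^{μ+ν−ηρ}`). [cite: Mullner2017, Lemma 5.2] -/
theorem card_carryExceptionsBox_le {k : ℕ} (hk : 2 ≤ k) {η C : ℝ} {f : ℕ → G}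
    (hf : HasCarryProperty k η C f) {μ ν ρ : ℕ} (h2ρ : 2 * ρ < ν) :
    ((carryExceptionsBox k f μ ν ρ).card : ℝ) ≤
      3 * k * C * (k : ℝ) ^ ((μ : ℝ) + ν - η * ρ) := by
  classical
  have hk0 : 0 < k := by omega
  have hkR : (0 : ℝ) < k := by exact_mod_cast hk0
  set CV := carryViolations k f (ν - ρ) (μ + ρ) ρ with hCV
  -- (1) integer count: fibre over the quotient `mn / k^{μ+ρ}`
  have hsub : carryExceptionsBox k f μ ν ρ ⊆
      (Ico (k ^ (μ - 1)) (k ^ μ) ×ˢ Ico (k ^ (ν - 1)) (k ^ ν)).filter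
        (fun p : ℕ × ℕ => p.1 * p.2 / k ^ (μ + ρ) ∈ CV) := by
    intro p hp
    have hp' := mem_carryExceptionsBox.1 hp
    exact mem_filter.2 ⟨mem_product.2 ⟨mem_Ico.2 hp'.1, mem_Ico.2 hp'.2.1⟩,
      carryExceptionsBox_subset hk f μ ν ρ hp⟩
  have hcount : (carryExceptionsBox k f μ ν ρ).card ≤ CV.card * (k ^ μ * (k ^ (ρ + 1) + 2)) := by
    refine (card_le_card hsub).trans ?_
    have hfib := card_eq_sum_card_fiberwise (f := fun p : ℕ × ℕ => p.1 * p.2 / k ^ (μ + ρ))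
      (s := (Ico (k ^ (μ - 1)) (k ^ μ) ×ˢ Ico (k ^ (ν - 1)) (k ^ ν)).filter
        (fun p : ℕ × ℕ => p.1 * p.2 / k ^ (μ + ρ) ∈ CV)) (t := CV)
      (fun p hp => (mem_filter.1 hp).2)
    rw [hfib]
    calc ∑ ℓ' ∈ CV, (((Ico (k ^ (μ - 1)) (k ^ μ) ×ˢ Ico (k ^ (ν - 1)) (k ^ ν)).filter
          (fun p : ℕ × ℕ => p.1 * p.2 / k ^ (μ + ρ) ∈ CV)).filter
            fun p : ℕ × ℕ => p.1 * p.2 / k ^ (μ + ρ) = ℓ').card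
        ≤ ∑ _ℓ' ∈ CV, k ^ μ * (k ^ (ρ + 1) + 2) := by
          refine sum_le_sum fun ℓ' _ => ?_
          refine le_trans (card_le_card ?_) (card_filter_box_div_eq_le hk μ ν ρ ℓ')
          intro p hp
          rw [mem_filter] at hp ⊢
          exact ⟨(mem_filter.1 hp.1).1, hp.2⟩
      _ = CV.card * (k ^ μ * (k ^ (ρ + 1) + 2)) := by rw [sum_const, smul_eq_mul]
  -- (2) the carry property bounds `#CV`
  have hCVle : (CV.card : ℝ) ≤ C * (k : ℝ) ^ (((ν - ρ : ℕ) : ℝ) - η * ρ) :=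
    hf (ν - ρ) (μ + ρ) ρ (by omega)
  have hC0 : 0 ≤ C := by
    have h0 : (0 : ℝ) ≤ CV.card := Nat.cast_nonneg _
    have hpos : (0 : ℝ) < (k : ℝ) ^ (((ν - ρ : ℕ) : ℝ) - η * ρ) := Real.rpow_pos_of_pos hkR _
    nlinarith [h0.trans hCVle]
  -- (3) assemble in `ℝ`
  have hbox : ((k ^ μ * (k ^ (ρ + 1) + 2) : ℕ) : ℝ) ≤ 3 * k * (k : ℝ) ^ (μ + ρ) := by
    have h2 : (2 : ℝ) ≤ 2 * (k : ℝ) ^ (ρ + 1) := by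
      have : (1 : ℝ) ≤ (k : ℝ) ^ (ρ + 1) := one_le_pow₀ (by exact_mod_cast hk0)
      linarith
    push_cast
    calc (k : ℝ) ^ μ * ((k : ℝ) ^ (ρ + 1) + 2) ≤ (k : ℝ) ^ μ * (3 * (k : ℝ) ^ (ρ + 1)) := by
          gcongr; linarith
      _ = 3 * k * (k : ℝ) ^ (μ + ρ) := by ring
  have hνρ : (((ν - ρ : ℕ) : ℝ)) = (ν : ℝ) - ρ := by
    rw [Nat.cast_sub (by omega)]
  calc ((carryExceptionsBox k f μ ν ρ).card : ℝ)
      ≤ (CV.card : ℝ) * ((k ^ μ * (k ^ (ρ + 1) + 2) : ℕ) : ℝ) := by exact_mod_cast hcount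
    _ ≤ (C * (k : ℝ) ^ (((ν - ρ : ℕ) : ℝ) - η * ρ)) * (3 * k * (k : ℝ) ^ (μ + ρ)) := by
        gcongr
    _ = 3 * k * C * ((k : ℝ) ^ (((ν - ρ : ℕ) : ℝ) - η * ρ) * (k : ℝ) ^ ((μ + ρ : ℕ) : ℝ)) := by
        rw [Real.rpow_natCast]; ring
    _ = 3 * k * C * (k : ℝ) ^ ((μ : ℝ) + ν - η * ρ) := by
        rw [← Real.rpow_add hkR, hνρ]
        congr 1
        push_cast
        ring_nf

end CarryBox

end Literature.NumberTheory.LFunctions
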